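import Literature.NumberTheory.EllipticCurves.ShaIsogenyProofs
import Literature.NumberTheory.EllipticCurves.IwasawaSelmerDualProofs
import Literature.NumberTheory.EllipticCurves.SelmerCorankProofs
import Literature.NumberTheory.EllipticCurves.IsogenyDualProofs
import HarnessLib

/-!
# `Sel_{p^∞}(E/L) → Sel_{p^∞}(E'/L)` along a `K`-isogeny, over any `L = K̄^H` (in particular over a
# `ℤ_p`-extension `K_∞`), with `Sel(φ̂) ∘ Sel(φ) = deg φ`
# (cell `b2b-bsdres`, unit `b2b-bsdres-eisenstein-p2`, gen 18)

HONEST FRAMING (run/shared/lean/b2b/bsd-rank1-residual/, verbatim in every file): the goal of the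
cell is to DELETE the COMBINATION-SHAPED residual classes of the Birch–Swinnerton-Dyer formula for
ALL analytic-rank `≤ 1` elliptic curves over `ℚ` — "full BSD formula for every rank `≤ 1` curve in
class `C`" assembled STRICTLY from published theorems — so that the rank-`≤ 1` remainder becomes
exactly the CONSTRUCTION-SHAPED classes, which are TYPED (missing-input `Prop`s), NOT attempted.
This is not "finishing BSD". Research route; NO CLAIM BEYOND STATED CLASSES; nothing here changes
a label. Definitions with bodies (`primaryTorsionMap`, `h1Map`, `selmerMap`, `isogenySelmerInftyMap`)
and theorems; no named fact.

WHY (X2-GAP §22.6 (iii), GV CASE 2; GV 2000 p. 28: "The `λ`-invariant is always unchanged by an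
isogeny"). The kernel version of that sentence needs the functoriality of the tree's Selmer group
`Sel_{p^∞}(E/K_∞) = WeierstrassCurve.selmerInfty` (`IwasawaSelmer`, `SubgroupSelmer`: classes of
`H¹(Gal(K̄/K_∞), E[p^∞])` satisfying the local condition at every place of `K_∞`) along a
`K`-isogeny. The tree had this for `Ш` and `H¹(K, E)` (`ShaIsogeny.lean`, Milne *ADT* I.7.1(b), with
the geometric input `Isogeny.hasLocalPointsMaps_holds` PROVED in `ShaIsogenyProofs.lean`) but not
for the Selmer group over `L = K̄^H`; this file transposes that construction:

* §1 `primaryTorsionMap` — `f|E[p^∞] : E[p^∞] → E'[p^∞]` for an additive `f : E(K̄) → E'(K̄)`,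
  equivariant when `f` is;
* §2 `h1Map p H f hf : H¹(H, E[p^∞]) → H¹(H, E'[p^∞])` (the tree's `resH1Hom` for the pair
  `(id_H, f|E[p^∞])`), on cocycles `[a] ↦ [f ∘ a]`, functorial, `H¹(H,g) ∘ H¹(H,f) = n` when
  `g ∘ f = [n]`, and commuting with the conjugation action `conjH1` of `Γ_K` (for `H` normal);
* §3 `h1Map_mem_selmerGroupOver` / `selmerMap` — `H¹(H, f)` respects the local kernels at every
  `K`-field (given local points maps of `f`, `HasLocalPointsMaps`) hence maps `Sel_{p^∞}(E/L)` into
  `Sel_{p^∞}(E'/L)`; `Sel(g) ∘ Sel(f) = n`;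
* §4 `isogenySelmerInftyMap p κ φ : Sel_{p^∞}(E/K_∞) → Sel_{p^∞}(E'/K_∞)` for a `K`-isogeny `φ` of
  curves over a number field (local points maps by `Isogeny.hasLocalPointsMaps_holds`),
  `isogenySelmerInftyMap_comp_apply` (`Sel(ψ) ∘ Sel(φ) = n` for `ψ ∘ φ = [n]`, e.g. the dual
  isogeny, Silverman III.6.1(a)), and compatibility with `conj_γ`.

Sequel: `X2/IsogenyLambdaInvariant.lean` (`λ(X(E/K_∞)) = λ(X(E'/K_∞))`).

References: [GreenbergVatsal2000] §2 p. 28; [MilneADT2006] I.§6–7 (Lemma 7.1(b));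
[SerreGaloisCohomology1997] I.§2.4–2.5; [SilvermanAEC2009] III.4, III.6.1; [GreenbergLNM1716] §1–2;
HOME/b2b-bsdres-eisenstein-p2/X2-GAP.md §23.
-/

set_option autoImplicit false

noncomputable section

open scoped Classical

universe u

open WeierstrassCurve Literature.NumberTheory.EllipticCurves Literature.NumberTheory.GaloisRepresentations
  Field IsDedekindDomain NumberField

namespace Summit.BirchSwinnertonDyer.Rank1Residual.X2.IsogenySelmerInfty

variable {K : Type u} [Field K] {W W' W'' : WeierstrassCurve K} (p : ℕ)

/-! ## §1. An equivariant homomorphism of geometric points on the `p`-primary torsion -/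

/-- An additive map `E(K̄) → E'(K̄)` carries `E[p^∞]` into `E'[p^∞]`. [folklore] -/
theorem map_geomPrimaryTorsion_le (f : W.geomPoints →+ W'.geomPoints) :
    (geomPrimaryTorsion W p).map f ≤ geomPrimaryTorsion W' p := by
  rintro _ ⟨P, hP, rfl⟩
  obtain ⟨k, hk⟩ := hP
  exact ⟨k, by rw [← map_nsmul, hk, map_zero]⟩

/-- **`f|E[p^∞] : E[p^∞] → E'[p^∞]`**, the restriction of an additive map of geometric points to
the `p`-primary torsion. [folklore] -/
def primaryTorsionMap (f : W.geomPoints →+ W'.geomPoints) :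
    geomPrimaryTorsion W p →+ geomPrimaryTorsion W' p :=
  (f.comp (geomPrimaryTorsion W p).subtype).codRestrict _ fun m ↦
    map_geomPrimaryTorsion_le p f ⟨m, m.2, rfl⟩

/-- Values of `primaryTorsionMap`. [folklore] -/
@[simp]
theorem coe_primaryTorsionMap (f : W.geomPoints →+ W'.geomPoints) (m : geomPrimaryTorsion W p) :
    ((primaryTorsionMap p f m : geomPrimaryTorsion W' p) : W'.geomPoints) = f m :=
  rfl

/-- `primaryTorsionMap` is compatible with composition. [folklore] -/
theorem primaryTorsionMap_comp (f : W.geomPoints →+ W'.geomPoints)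
    (g : W'.geomPoints →+ W''.geomPoints) :
    (primaryTorsionMap p g).comp (primaryTorsionMap p f) = primaryTorsionMap p (g.comp f) := by
  ext m; rfl

/-- Equivariance of `primaryTorsionMap` for a `Γ_K`-equivariant `f`. [folklore] -/
theorem primaryTorsionMap_smul (f : W.geomPoints →+ W'.geomPoints)
    (hf : ∀ (σ : absoluteGaloisGroup K) (P : W.geomPoints), f (σ • P) = σ • f P)
    (σ : absoluteGaloisGroup K) (m : geomPrimaryTorsion W p) :
    primaryTorsionMap p f (σ • m) = σ • primaryTorsionMap p f m :=
  Subtype.ext (by simp [primaryComponent.coe_smul, hf])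

/-! ## §2. The induced map on `H¹(H, E[p^∞])` for a subgroup `H ≤ Γ_K` -/

section H1

variable (H : Subgroup (absoluteGaloisGroup K))

/-- The compatibility of the pair `(id_H, f|E[p^∞])` (`H` acting through `H ≤ Γ_K`). [folklore] -/
theorem primaryTorsionMap_smul_subgroup (f : W.geomPoints →+ W'.geomPoints)
    (hf : ∀ (σ : absoluteGaloisGroup K) (P : W.geomPoints), f (σ • P) = σ • f P)
    (x : H) (m : geomPrimaryTorsion W p) :
    primaryTorsionMap p f (ContinuousMonoidHom.id H x • m) = x • primaryTorsionMap p f m := by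
  rw [Subgroup.smul_def, Subgroup.smul_def]
  exact primaryTorsionMap_smul p f hf x m

/-- **`H¹(H, f) : H¹(H, E[p^∞]) → H¹(H, E'[p^∞])`** for a subgroup `H ≤ Γ_K` (`H = Gal(K̄/L)`)
and a `Γ_K`-equivariant `f : E(K̄) → E'(K̄)`: the tree's `resH1Hom` for the compatible pair
`(id_H, f|E[p^∞])`. Serre, *Galois Cohomology*, I.§2.4. [folklore] -/
def h1Map (f : W.geomPoints →+ W'.geomPoints)
    (hf : ∀ (σ : absoluteGaloisGroup K) (P : W.geomPoints), f (σ • P) = σ • f P) :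
    W.subgroupH1 p H →+ W'.subgroupH1 p H :=
  resH1Hom (ContinuousMonoidHom.id H) (primaryTorsionMap p f) (primaryTorsionMap_smul_subgroup p H f hf)

/-- `H¹(H, f)` on explicit cocycles: `[a] ↦ [f ∘ a]`. [folklore] -/
theorem h1Map_oneCocycleClass (f : W.geomPoints →+ W'.geomPoints)
    (hf : ∀ (σ : absoluteGaloisGroup K) (P : W.geomPoints), f (σ • P) = σ • f P)
    (a : contOneCocycles (discreteTopRep H (geomPrimaryTorsion W p))) :
    h1Map p H f hf (oneCocycleClass _ a) =
      oneCocycleClass _ (contOneCocycles.push (primaryTorsionMap p f)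
        (primaryTorsionMap_smul_subgroup p H f hf) a) :=
  resH1Hom_id_oneCocycleClass _ _ a

/-- **Functoriality**: `H¹(H, g) ∘ H¹(H, f) = H¹(H, g ∘ f)`. [folklore] -/
theorem h1Map_h1Map (f : W.geomPoints →+ W'.geomPoints)
    (hf : ∀ (σ : absoluteGaloisGroup K) (P : W.geomPoints), f (σ • P) = σ • f P)
    (g : W'.geomPoints →+ W''.geomPoints)
    (hg : ∀ (σ : absoluteGaloisGroup K) (Q : W'.geomPoints), g (σ • Q) = σ • g Q)
    (c : W.subgroupH1 p H) :
    h1Map p H g hg (h1Map p H f hf c) =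
      h1Map p H (g.comp f) (fun σ P ↦ by simp [hf, hg]) c := by
  change ((h1Map p H g hg).comp (h1Map p H f hf)) c = _
  unfold h1Map
  rw [resH1Hom_comp]
  exact congrArg (fun F : W.subgroupH1 p H →+ W''.subgroupH1 p H ↦ F c)
    (resH1Hom_congr (by ext; rfl) (primaryTorsionMap_comp p f g) _ _)

/-- **`g ∘ f = [n]` ⟹ `H¹(H, g) ∘ H¹(H, f) = n`** on `H¹(H, E[p^∞])`. [folklore] -/
theorem h1Map_h1Map_of_comp_eq_nsmul (f : W.geomPoints →+ W'.geomPoints)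
    (hf : ∀ (σ : absoluteGaloisGroup K) (P : W.geomPoints), f (σ • P) = σ • f P)
    (g : W'.geomPoints →+ W.geomPoints)
    (hg : ∀ (σ : absoluteGaloisGroup K) (Q : W'.geomPoints), g (σ • Q) = σ • g Q)
    {n : ℕ} (h : ∀ P : W.geomPoints, g (f P) = (n : ℤ) • P) (c : W.subgroupH1 p H) :
    h1Map p H g hg (h1Map p H f hf c) = n • c := by
  obtain ⟨a, rfl⟩ := oneCocycleClass_surjective _ c
  rw [h1Map_oneCocycleClass, h1Map_oneCocycleClass]
  have hs := oneCocycleClass_smul (discreteTopRep H (geomPrimaryTorsion W p)) (n : ℤ) a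
  conv at hs => rhs; rw [Nat.cast_smul_eq_nsmul]
  rw [← hs]
  congr 1
  apply Subtype.ext
  ext σ
  change g (f ((a.1 σ : geomPrimaryTorsion W p) : W.geomPoints)) =
    (((n : ℤ) • a.1 σ : geomPrimaryTorsion W p) : W.geomPoints)
  rw [h, AddSubgroupClass.coe_zsmul]

/-- **`H¹(H, f)` commutes with the conjugation action** of `σ ∈ Γ_K` (for `H` normal): both
composites are induced by the compatible pair `(h ↦ σ⁻¹hσ, m ↦ σ • f m = f (σ • m))`. [folklore] -/
theorem h1Map_conjH1 [H.Normal] (f : W.geomPoints →+ W'.geomPoints)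
    (hf : ∀ (σ : absoluteGaloisGroup K) (P : W.geomPoints), f (σ • P) = σ • f P)
    (σ : absoluteGaloisGroup K) (c : W.subgroupH1 p H) :
    h1Map p H f hf (W.conjH1 p H σ c) = W'.conjH1 p H σ (h1Map p H f hf c) := by
  change ((h1Map p H f hf).comp (W.conjH1 p H σ)) c = ((W'.conjH1 p H σ).comp (h1Map p H f hf)) c
  unfold h1Map WeierstrassCurve.conjH1 Literature.NumberTheory.EllipticCurves.conjH1
  rw [resH1Hom_comp, resH1Hom_comp]
  refine congrArg (fun F : W.subgroupH1 p H →+ W'.subgroupH1 p H ↦ F c) (resH1Hom_congr ?_ ?_ _ _)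
  · ext; rfl
  · ext m
    simp only [AddMonoidHom.coe_comp, Function.comp_apply, DistribSMul.toAddMonoidHom_apply]
    exact congrArg Subtype.val (primaryTorsionMap_smul p f hf σ m)

end H1

/-! ## §3. The local conditions: `H¹(H, f)` maps `Sel_{p^∞}(E/L)` into `Sel_{p^∞}(E'/L)` -/

section Selmer

variable (H : Subgroup (absoluteGaloisGroup K)) {E : Type u} [Field E] [Algebra K E]

/-- **`H¹(H, f)` respects the local kernels** at the chosen place: if `f` extends to a
`Γ_E`-equivariant `f_E : E(K̄_E) → E'(K̄_E)` compatible with `K̄ → K̄_E`, then the square of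
compatible pairs commutes and `H¹(H, f)` maps `ker(H¹(H, E[p^∞]) → H¹(H_E, E(K̄_E)))` into the
corresponding kernel for `E'`. Serre, *Galois Cohomology*, I.§2.4. [folklore] -/
theorem h1Map_mem_localKerOver (f : W.geomPoints →+ W'.geomPoints)
    (hf : ∀ (σ : absoluteGaloisGroup K) (P : W.geomPoints), f (σ • P) = σ • f P)
    (fE : localPoints W E →+ localPoints W' E)
    (hfE : ∀ (τ : absoluteGaloisGroup E) (P : localPoints W E), fE (τ • P) = τ • fE P)
    (hcomp : ∀ P : W.geomPoints, fE (pointsMap W E P) = pointsMap W' E (f P))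
    {c : W.subgroupH1 p H} (hc : c ∈ W.localKerOver p H E) :
    h1Map p H f hf c ∈ W'.localKerOver p H E := by
  rw [WeierstrassCurve.mem_localKerOver_iff] at hc ⊢
  have hfE' : ∀ (τ : localSubgroup H E) (P : localPoints W E),
      fE (ContinuousMonoidHom.id (localSubgroup H E) τ • P) = τ • fE P := fun τ P ↦ by
    rw [Subgroup.smul_def, Subgroup.smul_def]
    exact hfE τ P
  have key : (W'.localResOver p H E).comp (h1Map p H f hf) =
      (resH1Hom (ContinuousMonoidHom.id (localSubgroup H E)) fE hfE').comp (W.localResOver p H E) := by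
    unfold h1Map WeierstrassCurve.localResOver WeierstrassCurve.localResOverOfEmb
    erw [resH1Hom_comp, resH1Hom_comp]
    refine resH1Hom_congr (by ext; rfl) ?_ _ _
    ext m
    exact (hcomp (m : W.geomPoints)).symm
  have hkey := congrArg (fun F : W.subgroupH1 p H →+ _ ↦ F c) key
  simp only [AddMonoidHom.comp_apply] at hkey
  rw [hkey, hc, map_zero]

variable [NumberField K] [H.Normal]

/-- **`H¹(H, f)` maps `Sel_{p^∞}(E/L)` into `Sel_{p^∞}(E'/L)`** (`L = K̄^H`) when `f` has local points
maps (e.g. any `K`-isogeny, `Isogeny.hasLocalPointsMaps_holds`): the local condition at every place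
of `K` and every conjugate (= every place of `L`) is respected (`h1Map_mem_localKerOver`,
`h1Map_conjH1`). Milne, *ADT*, I.§6–7; Greenberg LNM 1716 §2. [folklore] -/
theorem h1Map_mem_selmerGroupOver (f : W.geomPoints →+ W'.geomPoints)
    (hf : ∀ (σ : absoluteGaloisGroup K) (P : W.geomPoints), f (σ • P) = σ • f P)
    (hloc : HasLocalPointsMaps W W' f) {c : W.subgroupH1 p H} (hc : c ∈ W.selmerGroupOver p H) :
    h1Map p H f hf c ∈ W'.selmerGroupOver p H := by
  rw [WeierstrassCurve.mem_selmerGroupOver_iff] at hc ⊢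
  refine ⟨fun v σ ↦ ?_, fun w σ ↦ ?_⟩
  · obtain ⟨fE, hfE, hcomp⟩ := hloc (v.adicCompletion K)
    rw [← h1Map_conjH1]
    exact h1Map_mem_localKerOver p H f hf fE hfE hcomp (hc.1 v σ)
  · obtain ⟨fE, hfE, hcomp⟩ := hloc w.Completion
    rw [← h1Map_conjH1]
    exact h1Map_mem_localKerOver p H f hf fE hfE hcomp (hc.2 w σ)

/-- **`Sel(f) : Sel_{p^∞}(E/L) → Sel_{p^∞}(E'/L)`**, the restriction of `H¹(H, f)`. [folklore] -/
def selmerMap (f : W.geomPoints →+ W'.geomPoints)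
    (hf : ∀ (σ : absoluteGaloisGroup K) (P : W.geomPoints), f (σ • P) = σ • f P)
    (hloc : HasLocalPointsMaps W W' f) : W.selmerGroupOver p H →+ W'.selmerGroupOver p H :=
  ((h1Map p H f hf).comp (W.selmerGroupOver p H).subtype).codRestrict _ fun c ↦
    h1Map_mem_selmerGroupOver p H f hf hloc c.2

/-- Unfolding `selmerMap` on the underlying classes. [folklore] -/
@[simp]
theorem coe_selmerMap_apply (f : W.geomPoints →+ W'.geomPoints)
    (hf : ∀ (σ : absoluteGaloisGroup K) (P : W.geomPoints), f (σ • P) = σ • f P)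
    (hloc : HasLocalPointsMaps W W' f) (c : W.selmerGroupOver p H) :
    (selmerMap p H f hf hloc c : W'.subgroupH1 p H) = h1Map p H f hf c :=
  rfl

/-- **`Sel(g) ∘ Sel(f) = n`** when `g ∘ f = [n]`. [folklore] -/
theorem selmerMap_selmerMap_of_comp_eq_nsmul (f : W.geomPoints →+ W'.geomPoints)
    (hf : ∀ (σ : absoluteGaloisGroup K) (P : W.geomPoints), f (σ • P) = σ • f P)
    (hloc : HasLocalPointsMaps W W' f) (g : W'.geomPoints →+ W.geomPoints)
    (hg : ∀ (σ : absoluteGaloisGroup K) (Q : W'.geomPoints), g (σ • Q) = σ • g Q)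
    (hloc' : HasLocalPointsMaps W' W g)
    {n : ℕ} (h : ∀ P : W.geomPoints, g (f P) = (n : ℤ) • P) (c : W.selmerGroupOver p H) :
    selmerMap p H g hg hloc' (selmerMap p H f hf hloc c) = n • c := by
  apply Subtype.ext
  rw [coe_selmerMap_apply, coe_selmerMap_apply, AddSubmonoidClass.coe_nsmul]
  exact h1Map_h1Map_of_comp_eq_nsmul p H f hf g hg h c

/-- `Sel(f)` commutes with the conjugation action of `Γ_K` on the Selmer groups. [folklore] -/
theorem coe_selmerMap_conjH1 (f : W.geomPoints →+ W'.geomPoints)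
    (hf : ∀ (σ : absoluteGaloisGroup K) (P : W.geomPoints), f (σ • P) = σ • f P)
    (hloc : HasLocalPointsMaps W W' f) (σ : absoluteGaloisGroup K) (c : W.selmerGroupOver p H)
    (hσc : W.conjH1 p H σ c ∈ W.selmerGroupOver p H) :
    (selmerMap p H f hf hloc ⟨W.conjH1 p H σ c, hσc⟩ : W'.subgroupH1 p H) =
      W'.conjH1 p H σ (selmerMap p H f hf hloc c) := by
  rw [coe_selmerMap_apply, coe_selmerMap_apply]
  exact h1Map_conjH1 p H f hf σ c

end Selmer

/-! ## §4. Isogenies over a number field: `Sel_{p^∞}(E/K_∞) ⇄ Sel_{p^∞}(E'/K_∞)` with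
composites `deg`, and the dual maps on the Iwasawa modules -/

section Isogeny

variable [NumberField K] [Fact p.Prime] (κ : ZpExtension K p)

/-- **`Sel(φ) : Sel_{p^∞}(E/K_∞) → Sel_{p^∞}(E'/K_∞)` for a `K`-isogeny `φ : E → E'`** (local points
maps by `Isogeny.hasLocalPointsMaps_holds`). Greenberg LNM 1716 §1; GV 2000 p. 28 ("a
`p`-isogeny"). [folklore] -/
def isogenySelmerInftyMap (φ : Isogeny W W') : W.selmerInfty κ →+ W'.selmerInfty κ :=
  haveI : PerfectField K := PerfectField.ofCharZero
  selmerMap p κ.kerSubgroup φ.toAddMonoidHom φ.equivariant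
    (Isogeny.hasLocalPointsMaps_holds W W' φ)

/-- Unfolding: `Sel(φ)` is `H¹(Gal(K̄/K_∞), φ)` on classes. [folklore] -/
theorem coe_isogenySelmerInftyMap_apply (φ : Isogeny W W') (c : W.selmerInfty κ) :
    (isogenySelmerInftyMap p κ φ c : W'.subgroupH1 p κ.kerSubgroup) =
      h1Map p κ.kerSubgroup φ.toAddMonoidHom φ.equivariant c :=
  rfl

/-- **`Sel(ψ) ∘ Sel(φ) = deg φ`** on `Sel_{p^∞}(E/K_∞)` for an isogeny `φ` and any `ψ : E' → E` with
`ψ ∘ φ = [deg φ]` (the dual isogeny, Silverman III.6.1(a), tree `Isogeny.exists_dual_of_isElliptic`).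
[cite: SilvermanAEC2009, Thm. III.6.1(a)] -/
theorem isogenySelmerInftyMap_comp_apply (φ : Isogeny W W') (ψ : Isogeny W' W) {n : ℕ}
    (h : ∀ P : W.geomPoints, ψ (φ P) = (n : ℤ) • P) (c : W.selmerInfty κ) :
    isogenySelmerInftyMap p κ ψ (isogenySelmerInftyMap p κ φ c) = n • c :=
  haveI : PerfectField K := PerfectField.ofCharZero
  selmerMap_selmerMap_of_comp_eq_nsmul p κ.kerSubgroup φ.toAddMonoidHom φ.equivariant
    (Isogeny.hasLocalPointsMaps_holds W W' φ) ψ.toAddMonoidHom ψ.equivariant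
    (Isogeny.hasLocalPointsMaps_holds W' W ψ) (fun P ↦ h P) c

/-- `Sel(φ)` commutes with `conj_γ`. [folklore] -/
theorem coe_isogenySelmerInftyMap_conjH1 (φ : Isogeny W W') (γ : absoluteGaloisGroup K)
    (c : W.selmerInfty κ) (hγc : W.conjH1 p κ.kerSubgroup γ c ∈ W.selmerInfty κ) :
    (isogenySelmerInftyMap p κ φ ⟨W.conjH1 p κ.kerSubgroup γ c, hγc⟩ : W'.subgroupH1 p κ.kerSubgroup) =
      W'.conjH1 p κ.kerSubgroup γ (isogenySelmerInftyMap p κ φ c) :=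
  haveI : PerfectField K := PerfectField.ofCharZero
  coe_selmerMap_conjH1 p κ.kerSubgroup φ.toAddMonoidHom φ.equivariant
    (Isogeny.hasLocalPointsMaps_holds W W' φ) γ c hγc

end Isogeny

end Summit.BirchSwinnertonDyer.Rank1Residual.X2.IsogenySelmerInfty

end
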